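/-
Fleet lead `ym-wcr-19609-p1` (seat prover-ym-wcr-19609-p1-g2-0), route `WeakCouplingRates`, crux `BulkDominatesColdBoxW`
(stmt-QuantumFields-19609), line `dlr-chessboard` (v8): goodTD sandwich, step 3 — small circulations ⇒ `t ∈ goodTD` (datum twin of `smallField_subset_goodT`).
-/
import Summits.QuantumFields.YangMills.Theorems.WeakCouplingRatesBulkDominatesColdBoxWChartCoordsShiftBound
import Summits.QuantumFields.YangMills.Theorems.WeakCouplingRatesBulkDominatesColdBoxWKernelTransport
import Summits.QuantumFields.YangMills.Theorems.WeakCouplingRatesColdBoxTiltBoundDatum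

/-!
# Crux `BulkDominatesColdBoxW`, expansion stubs: the goodTD sandwich (datum twin of `smallField_subset_goodT`) and the Gaussian bad mass of `goodTD`

`smallField_subset_goodTD`: if every Dirichlet circulation of the colour triple `t` is `≤ R`, the scaled background circulations are `≤ R'`, the datum
is `≤ r` off the cold box and vanishes on the forest, and the windows `r² + 3ρ²/(2β) ≤ m² ≤ 1/16`, `3(R+R')²/(2β) + 362m³ < β^{2ε−1}` hold
(`ρ = (12H²+2H+1)((R+R') + 4√(2β)r)`), then `t ∈ goodTD H β ε ϑ`: chart coordinates are small (step 2 `sum_sq_extDatum_shift_le`), so every touching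
plaquette cost is its quadratic circulation `Σ_c (F'_c + dirCirc)²/(2β) ≤ 3(R+R')²/(2β)` up to `362m³` (`abs_plaqCostAt_gnomonic_sub_sum_sq_le`,
`sqrt_mul_sCirc_extDatum_eq`).  Consequently `gauss3_real_compl_goodTD_le`: `D^{⊗3}(goodTDᶜ) ≤ 720(2H+1)⁴e^{−R²/2}` (`gauss3_real_compl_smallField_le`).
No new definition; standard axioms.  NOT a claim about the mass gap.
-/

set_option autoImplicit false

noncomputable section

open Finset MeasureTheory
open Literature.Probability.LatticeModels Literature.MathematicalPhysics.QuantumLattice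
open Literature.MathematicalPhysics.QuantumFieldTheory Literature.MathematicalPhysics.QuantumFieldTheory.AxialGauge
open Literature.MathematicalPhysics.QuantumFieldTheory.LatticeMaxwell

namespace Summit.QuantumFields.YangMills.Theorems.WeakCouplingRates

variable {H : ℕ}

/-- **The goodTD sandwich** (datum twin of `smallField_subset_goodT`). -/
theorem smallField_subset_goodTD {β ε r R R' m : ℝ} (hβ : 0 < β) (hH : 1 ≤ H) (hr : 0 ≤ r) (hR : 0 ≤ R) (hR' : 0 ≤ R')
    {ϑ : Fin 3 → Literature.MathematicalPhysics.QuantumLattice.ZdEdge 4 → ℝ}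
    (hϑ : ∀ e, e ∉ boxEdges 4 (2 * H + 1) → ∑ c, ϑ c e ^ 2 ≤ r ^ 2)
    (hforest : ∀ x : Site 4, (∀ k : Fin 4, 1 ≤ x k ∧ x k + 1 ≤ 2 * (H : ℤ)) → ∀ c, ϑ c (x, 0) = 0)
    (hF : ∀ (c : Fin 3) (p : ZdPlaquette 4), |sCirc (glue (pin := fun e => e ∉ dirFreeEdges H) dirCorner (2 * H + 3) (sdat β ϑ c)
        (mean (fun e => e ∉ dirFreeEdges H) dirCorner (2 * H + 3) (sdat β ϑ c))) (p.1, p.2.1.1, p.2.1.2)| ≤ R')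
    (hm0 : 0 ≤ m)
    (hm : r ^ 2 + 3 * ((12 * (H : ℝ) ^ 2 + 2 * H + 1) * ((R + R') + 4 * (Real.sqrt (2 * β) * r))) ^ 2 / (2 * β) ≤ m ^ 2)
    (hm4 : m ≤ 1 / 4) (hwin : 3 * (R + R') ^ 2 / (2 * β) + 362 * m ^ 3 < β ^ (2 * ε - 1)) :
    {t : TSpace H | ∀ (c : Fin 3) (p : ZdPlaquette 4), |dirCirc H (p.1, p.2.1.1, p.2.1.2) (t c)| ≤ R} ⊆ goodTD H β ε ϑ := by
  intro t ht
  simp only [Set.mem_setOf_eq] at ht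
  -- chart coordinates
  set V : Literature.MathematicalPhysics.QuantumLattice.ZdEdge 4 → Fin 3 → ℝ :=
    fun e => extDatum (fun e c => ϑ c e) (unscaleT H β (t + meanT H β ϑ)) e with hV
  have hcoord : ∀ e, ∑ c, V e c ^ 2 ≤ m ^ 2 := fun e =>
    (sum_sq_extDatum_shift_le (β := β) hβ hH hr hR hR' hϑ hforest (t := t) ht hF e).trans hm
  have hcfg : cfgTD H β ϑ t = fun e => gnomonicChart (V e) := by
    funext e; rw [cfgTD_apply]
  rw [mem_goodTD_iff, mem_coldGoodSet_iff]
  intro p hp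
  rw [hcfg]
  -- Taylor
  have hT := abs_plaqCostAt_gnomonic_sub_sum_sq_le V p.1 p.2.1.1 p.2.1.2 hm0 hm4 (hcoord _) (hcoord _) (hcoord _) (hcoord _)
  -- the quadratic term
  have hc : 0 < Real.sqrt (2 * β) := Real.sqrt_pos.2 (by linarith)
  have h2β : Real.sqrt (2 * β) ^ 2 = 2 * β := Real.sq_sqrt (by linarith)
  have hedges : ((p.1, p.2.1.1) : Literature.MathematicalPhysics.QuantumLattice.ZdEdge 4) ∈ boxEdgesAt dirCorner (2 * H + 3) ∧
      ((p.1 + Pi.single p.2.1.1 1, p.2.1.2) : Literature.MathematicalPhysics.QuantumLattice.ZdEdge 4) ∈ boxEdgesAt dirCorner (2 * H + 3) ∧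
      ((p.1 + Pi.single p.2.1.2 1, p.2.1.1) : Literature.MathematicalPhysics.QuantumLattice.ZdEdge 4) ∈ boxEdgesAt dirCorner (2 * H + 3) ∧
      ((p.1, p.2.1.2) : Literature.MathematicalPhysics.QuantumLattice.ZdEdge 4) ∈ boxEdgesAt dirCorner (2 * H + 3) := by
    refine ⟨?_, ?_, ?_, ?_⟩ <;> apply plaquetteEdges_subset_enlarged hp <;> simp [plaquetteEdges]
  have hquad : ∑ c, (sCirc (fun e => V e c) ((p.1, p.2.1.1, p.2.1.2) : Plaq 4)) ^ 2 ≤ 3 * (R + R') ^ 2 / (2 * β) := by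
    have hk : ∀ c, (sCirc (fun e => V e c) ((p.1, p.2.1.1, p.2.1.2) : Plaq 4)) ^ 2 ≤ (R + R') ^ 2 / (2 * β) := by
      intro c
      have hid := sqrt_mul_sCirc_extDatum_eq (H := H) hβ ϑ hforest t c (p := ((p.1, p.2.1.1, p.2.1.2) : Plaq 4)) hedges
      have hbound : |Real.sqrt (2 * β) * sCirc (fun e => V e c) ((p.1, p.2.1.1, p.2.1.2) : Plaq 4)| ≤ R + R' := by
        rw [hV, hid, sCirc_glue_add_ofLp]
        calc _ ≤ |sCirc (glue (pin := fun e => e ∉ dirFreeEdges H) dirCorner (2 * H + 3) (sdat β ϑ c)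
              (mean (fun e => e ∉ dirFreeEdges H) dirCorner (2 * H + 3) (sdat β ϑ c))) (p.1, p.2.1.1, p.2.1.2)| +
              |dirCirc H (p.1, p.2.1.1, p.2.1.2) (t c)| := abs_add_le _ _
          _ ≤ R' + R := add_le_add (hF c p) (ht c p)
          _ = R + R' := add_comm _ _
      rw [abs_mul, abs_of_pos hc] at hbound
      rw [le_div_iff₀ (by linarith : (0 : ℝ) < 2 * β), ← h2β]
      have h' : |sCirc (fun e => V e c) ((p.1, p.2.1.1, p.2.1.2) : Plaq 4) * Real.sqrt (2 * β)| ≤ R + R' := by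
        rw [abs_mul, abs_of_pos hc, mul_comm]; exact hbound
      have := pow_le_pow_left₀ (abs_nonneg _) h' 2
      rwa [sq_abs, mul_pow] at this
    calc ∑ c, (sCirc (fun e => V e c) ((p.1, p.2.1.1, p.2.1.2) : Plaq 4)) ^ 2 ≤ ∑ _c : Fin 3, (R + R') ^ 2 / (2 * β) :=
        Finset.sum_le_sum fun c _ => hk c
      _ = 3 * (R + R') ^ 2 / (2 * β) := by rw [Finset.sum_const, Finset.card_univ, Fintype.card_fin, nsmul_eq_mul]; ring
  have := (abs_le.1 hT).2
  linarith

/-- **Gaussian mass of the complement of `goodTD`** under the sandwich hypotheses: `≤ 720(2H+1)⁴e^{−R²/2}`. -/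
theorem gauss3_real_compl_goodTD_le {β ε r R R' m : ℝ} (hβ : 0 < β) (hH : 1 ≤ H) (hr : 0 ≤ r) (hR : 0 ≤ R) (hR' : 0 ≤ R')
    {ϑ : Fin 3 → Literature.MathematicalPhysics.QuantumLattice.ZdEdge 4 → ℝ}
    (hϑ : ∀ e, e ∉ boxEdges 4 (2 * H + 1) → ∑ c, ϑ c e ^ 2 ≤ r ^ 2)
    (hforest : ∀ x : Site 4, (∀ k : Fin 4, 1 ≤ x k ∧ x k + 1 ≤ 2 * (H : ℤ)) → ∀ c, ϑ c (x, 0) = 0)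
    (hF : ∀ (c : Fin 3) (p : ZdPlaquette 4), |sCirc (glue (pin := fun e => e ∉ dirFreeEdges H) dirCorner (2 * H + 3) (sdat β ϑ c)
        (mean (fun e => e ∉ dirFreeEdges H) dirCorner (2 * H + 3) (sdat β ϑ c))) (p.1, p.2.1.1, p.2.1.2)| ≤ R')
    (hm0 : 0 ≤ m)
    (hm : r ^ 2 + 3 * ((12 * (H : ℝ) ^ 2 + 2 * H + 1) * ((R + R') + 4 * (Real.sqrt (2 * β) * r))) ^ 2 / (2 * β) ≤ m ^ 2)
    (hm4 : m ≤ 1 / 4) (hwin : 3 * (R + R') ^ 2 / (2 * β) + 362 * m ^ 3 < β ^ (2 * ε - 1)) :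
    (gauss3 H).real (goodTD H β ε ϑ)ᶜ ≤ 720 * (2 * (H : ℝ) + 1) ^ 4 * Real.exp (-R ^ 2 / 2) :=
  (measureReal_mono (Set.compl_subset_compl.2 (smallField_subset_goodTD hβ hH hr hR hR' hϑ hforest hF hm0 hm hm4 hwin))).trans
    (gauss3_real_compl_smallField_le H hR)

end Summit.QuantumFields.YangMills.Theorems.WeakCouplingRates

end
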